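import Literature.Geometry.Kaehler.ComplexTorusWeightCompactSupport
import Mathlib.MeasureTheory.Function.LocallyIntegrable
import HarnessLib

/-!
# Unfolding: a lattice-periodic locally integrable function pairs to zero with the second
# derivatives of the fundamental weight

Layer `Literature/Geometry/Kaehler`, namespace `Literature.Geometry.Kaehler.ComplexTorus`; lane
`lit-hodgefound`, prover seat `lit-hodgefound-p07`, generation 19 — third rider towards FILE C (torus
glue) of the programme «`[Θ_Ω] = -E_Ω` for every `Ω ∈ 𝔥_g`». With the fundamental weight
`w = w_univ` of the period lattice (Federer 4.1.7: `Σ_{λ ∈ Λ} w(x + λ) = 1`, smooth, compactly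
supported — `ComplexTorusChainPeriodicStokes.lean`, `ComplexTorusWeightCompactSupport.lean`):

* `sum_windowOn_fderiv_weight_eq_zero_of_mem` — `Σ_m Dw(Φm + y) = 0` on the open neighbourhood
  `{-1 < y_k < 2}` of the slab (the tree's `sum_windowOn_fderiv_weight_eq_zero`, on the slab only,
  re-proved on the open set);
* `sum_windowOn_fderiv_fderiv_weight_eq_zero` — hence `Σ_m D²w(Φm + x) = 0` on the slab;
* `integral_mul_fderiv_fderiv_weight_eq_zero` — **for a `Λ`-invariant measure `μ`, a locally
  `μ`-integrable `F` with `F(Φm + ·) = F` `μ`-a.e. for every `m ∈ ℤ^ι`, and any two vectors `u, v`: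
  `∫ F · D²w[u, v] dμ = 0`** — unfold over the slab (`integral_eq_sum_setIntegral_slab`), move the
  translates onto `w` by periodicity, and sum: `Σ_m D²w(Φm + x)[u, v] = 0`. In the torus glue this
  is applied to `F = log ‖ϑ‖ - π ᵗ(Im z)(Im Ω)⁻¹(Im z)` (periodic off the null set `Z(ϑ)`,
  `SiegelThetaLogNormPeriodic.lean`; locally integrable, `LogNormLocallyIntegrableSCV.lean`), so
  that `∫ log ‖ϑ‖ Δ_v w = π ∫ q Δ_v w`.

Theorems only; no definitions, no named facts.

## References

* [Federer1969] H. Federer, *Geometric Measure Theory*, Springer (1969), 4.1.7.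
* [Lange2023AbelianVarietiesComplex] H. Lange, *Abelian Varieties over the Complex Numbers* (2023),
  §1.1.1 (period parallelotope as a fundamental domain).
-/

noncomputable section

open Set Function MeasureTheory Filter Topology

namespace Literature.Geometry.Kaehler

namespace ComplexTorus

variable {ι : Type*} [DecidableEq ι] {E : Type*} [NormedAddCommGroup E] [NormedSpace ℂ E]
  (Φ : (ι → ℝ) ≃L[ℝ] E) (K : Finset ι)

/-- `Σ_{m ∈ window} Dw_K(Φm + y) = 0` at every point of the open region `{-1 < y_k < 2, k ∈ K}`
(where `Σ_m w_K(Φm + ·) ≡ 1`). [cite: Federer1969, 4.1.7] -/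
theorem sum_windowOn_fderiv_weight_eq_zero_of_mem {y : E}
    (hy : ∀ k ∈ K, Φ.symm y k ∈ Ioo (-1 : ℝ) 2) :
    ∑ m ∈ windowOn K, fderiv ℝ (weight Φ K) (latticeVecOn Φ K m + y) = 0 := by
  have hev : (fun y ↦ ∑ m ∈ windowOn K, weight Φ K (latticeVecOn Φ K m + y)) =ᶠ[𝓝 y]
      fun _ ↦ (1 : ℝ) :=
    Filter.eventually_of_mem ((isOpen_setOf_mem_Ioo Φ K).mem_nhds hy)
      fun y hy ↦ sum_windowOn_weight Φ K hy
  have h0 : fderiv ℝ (fun y ↦ ∑ m ∈ windowOn K, weight Φ K (latticeVecOn Φ K m + y)) y = 0 := by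
    rw [hev.fderiv_eq, fderiv_const_apply]
  have hdiff : ∀ m ∈ windowOn K,
      DifferentiableAt ℝ (fun y ↦ weight Φ K (latticeVecOn Φ K m + y)) y :=
    fun m _ ↦ ((contDiff_weight Φ K (n := 1)).differentiable one_ne_zero).differentiableAt.comp y
      ((differentiableAt_const _).add differentiableAt_id)
  rw [fderiv_fun_sum hdiff] at h0
  rw [← h0]
  refine Finset.sum_congr rfl fun m _ ↦ ?_
  rw [fderiv_comp_add_left]

/-- **`Σ_{m ∈ window} D²w_K(Φm + x) = 0` on the slab**: differentiate
`sum_windowOn_fderiv_weight_eq_zero_of_mem` once more on the open neighbourhood `{-1 < y_k < 2}`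
of the slab. [cite: Federer1969, 4.1.7] -/
theorem sum_windowOn_fderiv_fderiv_weight_eq_zero {x : E} (hx : x ∈ slab Φ K 0) :
    ∑ m ∈ windowOn K, fderiv ℝ (fderiv ℝ (weight Φ K)) (latticeVecOn Φ K m + x) = 0 := by
  have hx' : ∀ k ∈ K, Φ.symm x k ∈ Ioo (-1 : ℝ) 2 := fun k hk ↦ mem_Ioo_of_mem_slab Φ K hx hk
  have hev : (fun y ↦ ∑ m ∈ windowOn K, fderiv ℝ (weight Φ K) (latticeVecOn Φ K m + y)) =ᶠ[𝓝 x]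
      fun _ ↦ (0 : E →L[ℝ] ℝ) :=
    Filter.eventually_of_mem ((isOpen_setOf_mem_Ioo Φ K).mem_nhds hx')
      fun y hy ↦ sum_windowOn_fderiv_weight_eq_zero_of_mem Φ K hy
  have h0 : fderiv ℝ (fun y ↦ ∑ m ∈ windowOn K,
      fderiv ℝ (weight Φ K) (latticeVecOn Φ K m + y)) x = 0 := by
    rw [hev.fderiv_eq, fderiv_const_apply]
  have hd1 : Differentiable ℝ (fderiv ℝ (weight Φ K)) :=
    ((contDiff_weight Φ K (n := 2)).fderiv_right (m := 1) le_rfl).differentiable one_ne_zero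
  have hdiff : ∀ m ∈ windowOn K,
      DifferentiableAt ℝ (fun y ↦ fderiv ℝ (weight Φ K) (latticeVecOn Φ K m + y)) x :=
    fun m _ ↦ hd1.differentiableAt.comp x ((differentiableAt_const _).add differentiableAt_id)
  rw [fderiv_fun_sum hdiff] at h0
  rw [← h0]
  refine Finset.sum_congr rfl fun m _ ↦ ?_
  rw [fderiv_comp_add_left]

variable [Fintype ι] [MeasurableSpace E] [BorelSpace E]

/-- **A lattice-periodic locally integrable function pairs to zero with the second derivatives of
the fundamental weight.** Let `μ` be a `Λ`-invariant measure on `E` (`Λ = Φ(ℤ^ι)`), `F` locally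
`μ`-integrable with `F(Φm + ·) = F` `μ`-almost everywhere for every `m ∈ ℤ^ι`, and `w` the
fundamental weight of `Λ`. Then for all `u, v ∈ E`, `∫ F(x) · D²w(x)[u, v] dμ(x) = 0`:
unfolding over the slab fundamental domain, `∫ F D²w[u,v] = Σ_m ∫_{slab} F(Φm + x) D²w(Φm + x)[u,v]
= ∫_{slab} F(x) Σ_m D²w(Φm + x)[u,v] = 0`. [cite: Federer1969, 4.1.7;
Lange2023AbelianVarietiesComplex, §1.1.1] -/
theorem integral_mul_fderiv_fderiv_weight_eq_zero (μ : Measure E)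
    [VAddInvariantMeasure (coordSubLattice Φ (Finset.univ : Finset ι)) E μ]
    [IsLocallyFiniteMeasure μ] {F : E → ℝ} (hF : LocallyIntegrable F μ)
    (hper : ∀ m : ((Finset.univ : Finset ι) : Set ι) → ℤ,
      ∀ᵐ x ∂μ, F (latticeVecOn Φ Finset.univ m + x) = F x)
    (u v : E) :
    ∫ x, F x * fderiv ℝ (fderiv ℝ (weight Φ Finset.univ)) x u v ∂μ = 0 := by
  set w := weight Φ (Finset.univ : Finset ι) with hw
  set D2 : E → ℝ := fun x => fderiv ℝ (fderiv ℝ w) x u v with hD2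
  -- `D²w[u,v]` is continuous with compact support inside `spt w`
  have hwc : HasCompactSupport w := hasCompactSupport_weight_univ Φ
  have hD2c : Continuous D2 := by
    have h2 : Continuous (fderiv ℝ (fderiv ℝ w)) :=
      ((contDiff_weight Φ Finset.univ (n := 2)).fderiv_right (m := 1) le_rfl).continuous_fderiv
        one_ne_zero
    exact (h2.clm_apply continuous_const).clm_apply continuous_const
  have hD2t : tsupport D2 ⊆ tsupport w :=
    (tsupport_comp_subset (g := fun L : E →L[ℝ] E →L[ℝ] ℝ => L u v) rfl _).trans
      ((tsupport_fderiv_subset ℝ).trans (tsupport_fderiv_subset ℝ))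
  have hD2s : HasCompactSupport D2 := hwc.of_isClosed_subset (isClosed_tsupport _) hD2t
  -- integrability of `F · D²w[u,v](Φm + ·)` for every translate
  have hint_tr : ∀ c : E, Integrable (fun x => F x * D2 (c + x)) μ := fun c => by
    have hc : Continuous fun x => D2 (c + x) := hD2c.comp (continuous_const.add continuous_id)
    have hs : HasCompactSupport fun x => D2 (c + x) := by
      simpa [Function.comp_def, add_comm] using hD2s.comp_homeomorph (Homeomorph.addLeft c)
    simpa [smul_eq_mul] using hF.integrable_smul_right_of_hasCompactSupport hc hs
  have hint : Integrable (fun x => F x * D2 x) μ := by simpa using hint_tr 0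
  -- translates off the window vanish on the slab
  have hG : ∀ (m : ((Finset.univ : Finset ι) : Set ι) → ℤ), ∀ x ∈ slab Φ Finset.univ 0,
      F (latticeVecOn Φ Finset.univ m + x) * D2 (latticeVecOn Φ Finset.univ m + x) ≠ 0 →
        m ∈ windowOn Finset.univ := by
    intro m x hx hne
    have hD : D2 (latticeVecOn Φ Finset.univ m + x) ≠ 0 := fun h => hne (by rw [h, mul_zero])
    have hsupp : latticeVecOn Φ Finset.univ m + x ∈ tsupport w :=
      hD2t (subset_tsupport _ (mem_support.2 hD))
    have hco := tsupport_weight_subset Φ Finset.univ hsupp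
    rw [windowOn, Fintype.mem_piFinset]
    intro k
    have hk := hco k k.2
    rw [map_add, Pi.add_apply, symm_latticeVecOn_apply_of_mem Φ Finset.univ m k.2] at hk
    have hxk := (mem_slab_iff Φ Finset.univ).1 hx k k.2
    simp only [mem_Icc, mem_Ico, Pi.zero_apply, zero_add] at hk hxk
    refine mem_window_of_lt_of_lt ?_ ?_
    · have : (-2 : ℝ) < (m k : ℝ) := by linarith [hk.1, hxk.2]
      exact_mod_cast this
    · have : ((m k : ℤ) : ℝ) < 3 := by linarith [hk.2, hxk.1]
      exact_mod_cast this
  rw [integral_eq_sum_setIntegral_slab Φ Finset.univ hint (windowOn Finset.univ) hG]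
  -- move the translates onto the weight by periodicity
  have hshift : ∀ m ∈ windowOn (Finset.univ : Finset ι),
      ∫ x in slab Φ Finset.univ 0, F (latticeVecOn Φ Finset.univ m + x) *
          D2 (latticeVecOn Φ Finset.univ m + x) ∂μ =
        ∫ x in slab Φ Finset.univ 0, F x * D2 (latticeVecOn Φ Finset.univ m + x) ∂μ := by
    intro m _
    refine integral_congr_ae ?_
    filter_upwards [ae_restrict_of_ae (hper m)] with x hx
    rw [hx]
  rw [Finset.sum_congr rfl hshift, ← integral_finsetSum _ fun m _ => (hint_tr _).integrableOn]
  -- the summed second derivatives vanish on the slab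
  refine (setIntegral_congr_fun (measurableSet_slab Φ Finset.univ 0) fun x hx => ?_).trans
    (integral_zero _ _)
  rw [← Finset.mul_sum]
  have h0 := sum_windowOn_fderiv_fderiv_weight_eq_zero Φ Finset.univ hx
  have h0' : ∑ m ∈ windowOn Finset.univ, D2 (latticeVecOn Φ Finset.univ m + x) = 0 := by
    have := congrArg (fun L : E →L[ℝ] E →L[ℝ] ℝ => L u v) h0
    simpa only [sum_apply, zero_apply, hD2] using this
  rw [h0', mul_zero]

end ComplexTorus

end Literature.Geometry.Kaehler
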